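/-
Copyright (c) 2026 the pub-hodgecm-mathlib formalisation cell (harness21).  Prover seat hodgecm-mathlib-K2Liu-p14 (g3), Track B «K2-LIT»,
#184♮ = hLiu418 = `stmt-HodgeConjecture-24832`; Road I v3, S5-F3 lineage ∕ I4-conv (F′-fact), FILE B: the LOCAL letters of the Klingen fibre (definition lane).
-/
import Summits.HodgeConjecture.HodgeConjecture.Theorems.K2LiuKlingenUnipotentAdelicDefs    -- ★ F-letters: `jAdelic`, `nKlingen`, `klingenLevi`, `weylXi` (generic ring `R`, involution `σ`)
import Literature.NumberTheory.Automorphic.UnitaryGroupPlaceInclusion                    -- ★ `inclPlace`, `inclPlaceAdelic`, `evalPlace_finPart_inclPlaceAdelic`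
import Literature.NumberTheory.Automorphic.UnitaryGroupBorelInduction                     -- ★ `conjLocal_conjLocal_cm`
import HarnessLib

/-!
# Crux `HLiu418`, I4-conv (F′-fact), FILE B — `K2LiuKlingenInnerSectionLocalDefs`: THE LOCAL LETTERS OF THE KLINGEN FIBRE AT A FINITE PLACE `v` OF `L⁺`
# `Y_v`, `j_v : U(J_N)(L_v, c ⊗ 1) ≃* U(J_N)(L⁺_v)`, `n_{Q,v}`, `m_{Q,v}`, `ξ_v`, the place component `Ψ_v` of a transport `Ψ`, and `(Ψ g)_v = Ψ_v(g_v)`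

Cell `hodgecm-mathlib`, crux item hLiu418 = `stmt-HodgeConjecture-24832`; squad K2 ∕ K2Liu; LEAD F0P6-plan (g14) BATCH #36 (q3) «D → B → E»; prover K2Liu-p14 (g3)
(census `K2/K2Liu-p14/g3/CENSUS-I4conv-FprimeFact.K2Liu-p14-g3.md` §2 FILE B).  DEFINITIONS LEAF (R6: `def`s with bodies + unfolding ∕ structure theorems; no
`instance`, no notation, no named-fact hypothesis, no `sorry`); lane `--kind definition --supports stmt-HodgeConjecture-24832 --as helper` (count-neutral).

THE POINT.  The inner section of term 2 of the Klingen constant term, `F′_h(y) = ∫_{Y(𝔸)×𝔸_L} f(Ψ(ξ)·Ψ(n_Q(q.1,0,q.2))·Ψ(m_Q(1,j₂⁻¹y))·h) d(μ_Y ⊗ μ_T)` (★ F8 ∕ F5-q),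
is to be EULER-FACTORISED (★ FILE D `K2LiuKlingenInnerSectionEuler.integral_eq_mul_tprod_of_map_eq`: splitting `hmap` = FILE D0, integrand shape `hF` = THIS file's
letters + ★ #31s).  The global letters of the F-files are adelic matrices over `(𝔸_L, c ⊗ 1)` read in `(quasiSplit L⁺ L c N).Adelic` through ★ `jAdelic`; the local
letters are the SAME generic-ring matrices (★ `K2LiuKlingenParabolicDefs`: `nKlingen`, `klingenLevi`, `weylXi` over ANY `(R, σ)`) over the local algebra
`L_v = Π_{w∣v} L_w` (★ `UnitaryGroup.LocalRing`) with its involution `c ⊗ 1` (★ `conjLocal`, involutive: ★ `conjLocal_conjLocal_cm`), read in the restricted-product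
factor `U(J_N)(L⁺_v)` (★ `UnitaryGroup.localPi`, home of ★ `LambdaLoc`, `localInt`, `IsSphericalSection`) through `j_v` + ★ `localPiEquiv`.
* §1 `skewLoc v` (`Y_v = {y ∈ L_v : (c⊗1)y = −y}`), `adeleToLocal_mem_skewLoc` (`y ∈ Y ⇒ y_v ∈ Y_v`).
* §2 `local_antidiagonal_eq`, **`jLoc N v`** (the identity on matrices `U(J_N)(L_v, c⊗1) ≃* U(J_N)(L⁺_v)`, local twin of ★ `jAdelic`), the local letters
  **`nKlingenLoc`, `klingenLeviLoc`, `weylXiLoc`** (elements of `localPi … 4 … v`) with their matrices, and the PLACE COMPONENTS of the adelic letters: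
  `evalPlace_finPart_jAdelic` (the `w`-matrix of `(jAdelic g)_v` is the `w`-evaluation of `g`), **`evalPlace_finPart_nKlingen`**, **`evalPlace_finPart_weylXi`**,
  **`evalPlace_finPart_klingenLevi_one`** (`(n_Q(y,z,t))_v = n_{Q,v}(y_v,z_v,t_v)`, `ξ_v`, `(m_Q(1, j₂⁻¹ y))_v = m_{Q,v}(1, (y)_v)`).
* §3 **`psiLoc Ψ v := (·)_v ∘ Ψ ∘ ι_v : U(J)(L⁺_v) →* U(J′)(L⁺_v)`** — the place component of ANY homomorphism `Ψ` of adelic unitary groups (★ `inclPlaceAdelic`,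
  ★ `finPart`, ★ `evalPlace`; definition-free in `Ψ`), and **`evalPlace_finPart_eq_psiLoc`**: if `Ψ` is conjugation by an adelic matrix (`hΨ`, the F-files' pin — e.g. F10's
  `Ψ : U(J₄)(𝔸) ≃ₜ* H(𝔸)` or ★ `K2LiuKlingenTermTwoTransport`'s `Ψ_S = adelicUnitaryGroupCongr L S _ _ hc` by ★ `coe_adelicUnitaryGroupCongr`) then `(Ψ g)_v = Ψ_v(g_v)`
  for every `g` — so the place components of `Ψ(ξ)·Ψ(n_Q(q))·Ψ(m_Q(1,j₂⁻¹y))·h` are `Ψ_v(ξ_v n_{Q,v}(q_v) m_{Q,v}(1,y_v))·h_v` (`psiLoc_letters`), which is the `hF` of FILE D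
  once `f_s` is ★ #31s-factorizable.  (The local inner functional `J_v` and its law∕sphericity are FILE C's; they are integrals of THESE letters.)
[CasselsFrohlichANT1967, Ch. II §10–§11], [PlatonovRapinchuk1994, §5.1], [BorelJacquet1979, §4.1], [Xiong2013, §7 Lemma 7.1], [MoeglinWaldspurger1995, II.1.7].
HONEST LABEL.  Count-neutral helper, closes no socket: `HC_CM` is proved only modulo the 7 printed citations (2 remaining named inputs: hLiu418 =
`stmt-HodgeConjecture-24832`, h413 = `stmt-HodgeConjecture-24833`) until rung 0 closes.
-/

set_option autoImplicit false
set_option linter.dupNamespace false -- the mandated namespace repeats `HodgeConjecture.HodgeConjecture`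

noncomputable section

open scoped Matrix
open NumberField IsDedekindDomain

namespace Summit.HodgeConjecture.HodgeConjecture.Cruxes.HLiu418.K2LiuKlingenInnerSectionLocalDefs

open Literature.NumberTheory.Automorphic Literature.NumberTheory.Automorphic.UnitaryGroup
open Literature.NumberTheory.GelbartRogawski1991 Literature.NumberTheory.GelbartRogawski1991.GRConstruction
open Summit.HodgeConjecture.HodgeConjecture.Cruxes.HLiu418.K2LiuKlingenParabolicDefs
open Summit.HodgeConjecture.HodgeConjecture.Cruxes.HLiu418.K2LiuKlingenUnipotentAdelicDefs
open Summit.HodgeConjecture.HodgeConjecture.Cruxes.HLiu418.K2LiuSiegelDoubledLeviMatrix (conjAdele_conjAdele')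

variable (L : Type) [Field L] [NumberField L] [IsCMField L]

/-! ## §1 The local skew line `Y_v` -/

/-- **`Y_v = {y ∈ L_v : (c ⊗ 1) y = −y}`**, the skew part of the local algebra `L_v = Π_{w∣v} L_w` (place component of the F-files' `Y ≤ 𝔸_L`, `hY : y ∈ Y ↔ c y = −y`).
[cite: CasselsFrohlichANT1967, Ch. II §10–§11] -/
def skewLoc (v : HeightOneSpectrum (𝓞 (Fp L))) : AddSubgroup (LocalRing L v) where
  carrier := {y | conjLocal L (IsCMField.complexConj L) v y = -y}
  add_mem' {a b} ha hb := by
    simp only [Set.mem_setOf_eq] at ha hb ⊢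
    rw [map_add, ha, hb, neg_add]
  zero_mem' := by simp only [Set.mem_setOf_eq, map_zero, neg_zero]
  neg_mem' {a} ha := by
    simp only [Set.mem_setOf_eq] at ha ⊢
    rw [map_neg, ha]

/-- membership in `Y_v`. [cite: CasselsFrohlichANT1967, Ch. II §10–§11] -/
theorem mem_skewLoc_iff (v : HeightOneSpectrum (𝓞 (Fp L))) (y : LocalRing L v) :
    y ∈ skewLoc L v ↔ conjLocal L (IsCMField.complexConj L) v y = -y := Iff.rfl

/-- **`y ∈ Y ⇒ y_v ∈ Y_v`** (★ `adeleToLocal_conj`). [cite: CasselsFrohlichANT1967, Ch. II §10–§11] -/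
theorem adeleToLocal_mem_skewLoc (v : HeightOneSpectrum (𝓞 (Fp L))) {y : AdeleRing (𝓞 L) L}
    (hy : conjAdele (Fp L) L (IsCMField.complexConj L) y = -y) : adeleToLocal L v y ∈ skewLoc L v := by
  rw [mem_skewLoc_iff, ← adeleToLocal_conj, hy, map_neg]

/-! ## §2 `j_v`, the local Klingen letters, and the place components of the adelic letters -/

/-- the local group of Mok's form IS the unitary group of `J_N` over `(L_v, c ⊗ 1)` (`adelicForm (J_N over L) ↦ J_N over L_v`, ★ `StdForm.over_map`).
[cite: Mok2014, §1 Notation p. 5] -/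
theorem local_antidiagonal_eq (N : ℕ) (v : HeightOneSpectrum (𝓞 (Fp L))) :
    UnitaryGroup.«local» L (IsCMField.complexConj L) N ((StdForm.antidiagonal N).over L) v =
      unitaryGroupOfForm (conjLocal L (IsCMField.complexConj L) v) ((StdForm.antidiagonal N).over (LocalRing L v)) := by
  rw [UnitaryGroup.«local», UnitaryGroup.adelicForm, StdForm.over_map, StdForm.over_map]

/-- **`j_v : U(J_N)(L_v, c ⊗ 1) ≃* U(J_N)(L⁺_v)`** (the identity on matrices, then ★ `localPiEquiv.symm` into the restricted-product factor `localPi`) — local twin of ★ `jAdelic`.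
[cite: Mok2014, §1 Notation p. 5] [cite: PlatonovRapinchuk1994, §5.1] -/
def jLoc (N : ℕ) (v : HeightOneSpectrum (𝓞 (Fp L))) :
    unitaryGroupOfForm (conjLocal L (IsCMField.complexConj L) v) ((StdForm.antidiagonal N).over (LocalRing L v)) ≃*
      UnitaryGroup.localPi L (IsCMField.complexConj L) N ((StdForm.antidiagonal N).over L) v :=
  (MulEquiv.subgroupCongr (local_antidiagonal_eq L N v).symm).trans
    (UnitaryGroup.localPiEquiv L (IsCMField.complexConj L) N ((StdForm.antidiagonal N).over L) v).symm.toMulEquiv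

/-- `j_v` on matrices: the `w`-component of `j_v g` is the `w`-component of the matrix of `g`. [cite: PlatonovRapinchuk1994, §5.1] -/
theorem coe_jLoc_apply (N : ℕ) (v : HeightOneSpectrum (𝓞 (Fp L)))
    (g : unitaryGroupOfForm (conjLocal L (IsCMField.complexConj L) v) ((StdForm.antidiagonal N).over (LocalRing L v))) (w : UnitaryGroup.PlacesOver L v) (i j : Fin N) :
    (((jLoc L N v g : UnitaryGroup.localPi L (IsCMField.complexConj L) N ((StdForm.antidiagonal N).over L) v) : UnitaryGroup.LocalGLPi L N v) w :
        Matrix (Fin N) (Fin N) (w.1.adicCompletion L)) i j =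
      (g : GL (Fin N) (LocalRing L v)).val i j w := rfl

/-- **`n_{Q,v}(y, z, t) ∈ U(J₄)(L⁺_v)`** (`y ∈ Y_v`): the local Klingen unipotent letter. [cite: Xiong2013, §7 Lemma 7.1] -/
def nKlingenLoc (v : HeightOneSpectrum (𝓞 (Fp L))) (y : LocalRing L v) (hy : conjLocal L (IsCMField.complexConj L) v y = -y) (z t : LocalRing L v) :
    UnitaryGroup.localPi L (IsCMField.complexConj L) 4 ((StdForm.antidiagonal 4).over L) v :=
  jLoc L 4 v (nKlingen (LocalRing L v) (conjLocal L (IsCMField.complexConj L) v) (conjLocal_conjLocal_cm L v) y hy z t)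

/-- **`m_{Q,v}(a, g) ∈ U(J₄)(L⁺_v)`**: the local Klingen Levi letter (`g ∈ U(J₂)(L⁺_v)` read through `j_v⁻¹`). [cite: Xiong2013, §7 Lemma 7.1] [cite: MoeglinWaldspurger1995, II.1.7] -/
def klingenLeviLoc (v : HeightOneSpectrum (𝓞 (Fp L))) (a : (LocalRing L v)ˣ)
    (g : UnitaryGroup.localPi L (IsCMField.complexConj L) 2 ((StdForm.antidiagonal 2).over L) v) :
    UnitaryGroup.localPi L (IsCMField.complexConj L) 4 ((StdForm.antidiagonal 4).over L) v :=
  jLoc L 4 v (klingenLevi (LocalRing L v) (conjLocal L (IsCMField.complexConj L) v) (conjLocal_conjLocal_cm L v) a ((jLoc L 2 v).symm g))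

/-- **`ξ_v ∈ U(J₄)(L⁺_v)`**: the local cell representative. [cite: Xiong2013, §7 Lemma 7.1] -/
def weylXiLoc (v : HeightOneSpectrum (𝓞 (Fp L))) : UnitaryGroup.localPi L (IsCMField.complexConj L) 4 ((StdForm.antidiagonal 4).over L) v :=
  jLoc L 4 v (weylXi (LocalRing L v) (conjLocal L (IsCMField.complexConj L) v))

/-- **place components of the adelic letters, I**: the `w`-matrix of `(jAdelic g)_v` is the `w`-evaluation of the adelic matrix of `g`
(★ `coe_evalPlace_apply`, ★ `coe_finPart`, ★ `coe_adelicVal_jAdelic`). [cite: BorelJacquet1979, §4.1] -/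
theorem evalPlace_finPart_jAdelic (N : ℕ) (v : HeightOneSpectrum (𝓞 (Fp L)))
    (g : unitaryGroupOfForm (conjAdele (Fp L) L (IsCMField.complexConj L)) ((StdForm.antidiagonal N).over (AdeleRing (𝓞 L) L))) (w : UnitaryGroup.PlacesOver L v) (i j : Fin N) :
    (((UnitaryGroup.evalPlace (Fp L) L (IsCMField.complexConj L) N ((StdForm.antidiagonal N).over L) v
        (UnitaryGroup.finPart (Fp L) L (IsCMField.complexConj L) N ((StdForm.antidiagonal N).over L) (jAdelic L N g)) :
          UnitaryGroup.localPi L (IsCMField.complexConj L) N ((StdForm.antidiagonal N).over L) v) : UnitaryGroup.LocalGLPi L N v) w :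
        Matrix (Fin N) (Fin N) (w.1.adicCompletion L)) i j =
      (((g : GL (Fin N) (AdeleRing (𝓞 L) L)) : Matrix (Fin N) (Fin N) (AdeleRing (𝓞 L) L)) i j).2 w.1 := by
  rw [UnitaryGroup.coe_evalPlace_apply, GLn.coe_evalAt_apply, UnitaryGroup.coe_finPart, ← coe_adelicVal_jAdelic L N g]
  rfl

/-- `j_v⁻¹` on matrices: the `w`-component of an entry of `j_v⁻¹ u` is the entry of the `w`-component of `u`. [cite: PlatonovRapinchuk1994, §5.1] -/
theorem coe_jLoc_symm_apply (N : ℕ) (v : HeightOneSpectrum (𝓞 (Fp L)))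
    (u : UnitaryGroup.localPi L (IsCMField.complexConj L) N ((StdForm.antidiagonal N).over L) v) (w : UnitaryGroup.PlacesOver L v) (i j : Fin N) :
    (((jLoc L N v).symm u : unitaryGroupOfForm (conjLocal L (IsCMField.complexConj L) v) ((StdForm.antidiagonal N).over (LocalRing L v))) :
        GL (Fin N) (LocalRing L v)).val i j w =
      (((u : UnitaryGroup.LocalGLPi L N v) w : GL (Fin N) (w.1.adicCompletion L)) : Matrix (Fin N) (Fin N) (w.1.adicCompletion L)) i j := rfl

omit [IsCMField L] in
/-- `n_Q` commutes with ring homomorphisms intertwining the involutions: `(n_Q(y,z,t)).map f = n_Q(f y, f z, f t)` (entries are polynomials in `y, z, t, σ y, σ z, σ t`).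
[cite: Xiong2013, §7 Lemma 7.1] -/
theorem nKlingenM_map {R R' : Type*} [CommRing R] [CommRing R'] (σ : R →+* R) (σ' : R' →+* R') (f : R →+* R') (hf : ∀ x, f (σ x) = σ' (f x))
    (y z t : R) : (nKlingenM R σ y z t).map f = nKlingenM R' σ' (f y) (f z) (f t) := by
  ext i j
  fin_cases i <;> fin_cases j <;> simp [nKlingenM, hf]

/-- the adelic matrix `n_Q(y,z,t)` read in `L_v` is the local matrix `n_{Q,v}(y_v, z_v, t_v)` (★ `adeleToLocal_conj`). [cite: Xiong2013, §7 Lemma 7.1] -/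
theorem nKlingenM_map_adeleToLocal (v : HeightOneSpectrum (𝓞 (Fp L))) (y z t : AdeleRing (𝓞 L) L) :
    (nKlingenM (AdeleRing (𝓞 L) L) (conjAdele (Fp L) L (IsCMField.complexConj L)) y z t).map (adeleToLocal L v) =
      nKlingenM (LocalRing L v) (conjLocal L (IsCMField.complexConj L) v) (adeleToLocal L v y) (adeleToLocal L v z) (adeleToLocal L v t) :=
  nKlingenM_map _ _ (adeleToLocal L v) (fun x => adeleToLocal_conj L (IsCMField.complexConj L) v x) y z t

omit [IsCMField L] in
/-- the constant matrix `ξ` is preserved by every ring homomorphism. [cite: Xiong2013, §7 Lemma 7.1] -/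
theorem weylXiM_map {R R' : Type*} [CommRing R] [CommRing R'] (f : R →+* R') : (weylXiM R).map f = weylXiM R' := by
  ext i j
  fin_cases i <;> fin_cases j <;> simp [weylXiM]

omit [IsCMField L] in
/-- `m_Q(1, g)` commutes with ring homomorphisms: `f (m_Q(1,g)_{ij}) = m_Q(1,g′)_{ij}` when `f` carries the entries of `g` to those of `g′`. [cite: Xiong2013, §7 Lemma 7.1] -/
theorem map_klingenLeviM_one {R R' : Type*} [CommRing R] [CommRing R'] (σ : R →+* R) (σ' : R' →+* R') (f : R →+* R')
    (g : unitaryGroupOfForm σ ((StdForm.antidiagonal 2).over R)) (g' : unitaryGroupOfForm σ' ((StdForm.antidiagonal 2).over R'))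
    (hg : ∀ a b, f ((g : GL (Fin 2) R).val a b) = (g' : GL (Fin 2) R').val a b) (i j : Fin 4) :
    f (klingenLeviM R σ 1 g i j) = klingenLeviM R' σ' 1 g' i j := by
  fin_cases i <;> fin_cases j <;> simp [klingenLeviM, hg]

/-- **place components of the adelic letters, II: `(n_Q(y,z,t))_v = n_{Q,v}(y_v, z_v, t_v)`** in `U(J₄)(L⁺_v)`. [cite: Xiong2013, §7 Lemma 7.1] [cite: BorelJacquet1979, §4.1] -/
theorem evalPlace_finPart_nKlingen (v : HeightOneSpectrum (𝓞 (Fp L))) (y : AdeleRing (𝓞 L) L) (hy : conjAdele (Fp L) L (IsCMField.complexConj L) y = -y)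
    (z t : AdeleRing (𝓞 L) L) :
    UnitaryGroup.evalPlace (Fp L) L (IsCMField.complexConj L) 4 ((StdForm.antidiagonal 4).over L) v
        (UnitaryGroup.finPart (Fp L) L (IsCMField.complexConj L) 4 ((StdForm.antidiagonal 4).over L)
          (jAdelic L 4 (nKlingen (AdeleRing (𝓞 L) L) (conjAdele (Fp L) L (IsCMField.complexConj L)) (conjAdele_conjAdele' L) y hy z t))) =
      nKlingenLoc L v (adeleToLocal L v y) ((mem_skewLoc_iff L v _).1 (adeleToLocal_mem_skewLoc L v hy)) (adeleToLocal L v z) (adeleToLocal L v t) := by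
  refine Subtype.ext (funext fun w => Units.ext (Matrix.ext fun i j => ?_))
  rw [evalPlace_finPart_jAdelic, coe_nKlingen]
  change _ = (((jLoc L 4 v _ : UnitaryGroup.localPi L (IsCMField.complexConj L) 4 ((StdForm.antidiagonal 4).over L) v) : UnitaryGroup.LocalGLPi L 4 v) w :
    Matrix (Fin 4) (Fin 4) (w.1.adicCompletion L)) i j
  rw [coe_jLoc_apply, coe_nKlingen, ← nKlingenM_map_adeleToLocal, Matrix.map_apply, adeleToLocal_apply]

/-- **place components, III: `ξ_v`** — the `v`-component of the adelic `ξ` is the local `ξ_v`. [cite: Xiong2013, §7 Lemma 7.1] [cite: BorelJacquet1979, §4.1] -/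
theorem evalPlace_finPart_weylXi (v : HeightOneSpectrum (𝓞 (Fp L))) :
    UnitaryGroup.evalPlace (Fp L) L (IsCMField.complexConj L) 4 ((StdForm.antidiagonal 4).over L) v
        (UnitaryGroup.finPart (Fp L) L (IsCMField.complexConj L) 4 ((StdForm.antidiagonal 4).over L)
          (jAdelic L 4 (weylXi (AdeleRing (𝓞 L) L) (conjAdele (Fp L) L (IsCMField.complexConj L))))) = weylXiLoc L v := by
  refine Subtype.ext (funext fun w => Units.ext (Matrix.ext fun i j => ?_))
  rw [evalPlace_finPart_jAdelic, coe_weylXi]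
  change _ = (((jLoc L 4 v _ : UnitaryGroup.localPi L (IsCMField.complexConj L) 4 ((StdForm.antidiagonal 4).over L) v) : UnitaryGroup.LocalGLPi L 4 v) w :
    Matrix (Fin 4) (Fin 4) (w.1.adicCompletion L)) i j
  rw [coe_jLoc_apply, coe_weylXi, ← weylXiM_map (adeleToLocal L v), Matrix.map_apply, adeleToLocal_apply]

set_option maxHeartbeats 400000 in -- MEASURED: instance-path unification `Pi.commRing (LocalRing L v)` vs the generic `[CommRing R']` of `map_klingenLeviM_one`
/-- **place components, IV: `(m_Q(1, j₂⁻¹ y))_v = m_{Q,v}(1, y_v)`** for `y ∈ U(J₂)(𝔸_{L⁺})` (`y_v = (y)_v ∈ U(J₂)(L⁺_v)`).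
[cite: Xiong2013, §7 Lemma 7.1] [cite: MoeglinWaldspurger1995, II.1.7] [cite: BorelJacquet1979, §4.1] -/
theorem evalPlace_finPart_klingenLevi_one (v : HeightOneSpectrum (𝓞 (Fp L))) (y : (quasiSplit (Fp L) L (IsCMField.complexConj L) 2).Adelic) :
    UnitaryGroup.evalPlace (Fp L) L (IsCMField.complexConj L) 4 ((StdForm.antidiagonal 4).over L) v
        (UnitaryGroup.finPart (Fp L) L (IsCMField.complexConj L) 4 ((StdForm.antidiagonal 4).over L)
          (jAdelic L 4 (klingenLevi (AdeleRing (𝓞 L) L) (conjAdele (Fp L) L (IsCMField.complexConj L)) (conjAdele_conjAdele' L) 1 ((jAdelic L 2).symm y)))) =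
      klingenLeviLoc L v 1
        (UnitaryGroup.evalPlace (Fp L) L (IsCMField.complexConj L) 2 ((StdForm.antidiagonal 2).over L) v
          (UnitaryGroup.finPart (Fp L) L (IsCMField.complexConj L) 2 ((StdForm.antidiagonal 2).over L) y)) := by
  have hy : ∀ a b : Fin 2,
      adeleToLocal L v (((((jAdelic L 2).symm y : unitaryGroupOfForm (conjAdele (Fp L) L (IsCMField.complexConj L)) ((StdForm.antidiagonal 2).over (AdeleRing (𝓞 L) L))) :
          GL (Fin 2) (AdeleRing (𝓞 L) L)).val a b)) =
        (((jLoc L 2 v).symm (UnitaryGroup.evalPlace (Fp L) L (IsCMField.complexConj L) 2 ((StdForm.antidiagonal 2).over L) v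
            (UnitaryGroup.finPart (Fp L) L (IsCMField.complexConj L) 2 ((StdForm.antidiagonal 2).over L) y)) :
          unitaryGroupOfForm (conjLocal L (IsCMField.complexConj L) v) ((StdForm.antidiagonal 2).over (LocalRing L v))) : GL (Fin 2) (LocalRing L v)).val a b := by
    intro a b
    funext w
    rw [adeleToLocal_apply, coe_jLoc_symm_apply, ← evalPlace_finPart_jAdelic L 2 v ((jAdelic L 2).symm y) w a b, MulEquiv.apply_symm_apply]
  refine Subtype.ext (funext fun w => Units.ext (Matrix.ext fun i j => ?_))
  rw [evalPlace_finPart_jAdelic, coe_klingenLevi]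
  change _ = (((jLoc L 4 v _ : UnitaryGroup.localPi L (IsCMField.complexConj L) 4 ((StdForm.antidiagonal 4).over L) v) : UnitaryGroup.LocalGLPi L 4 v) w :
    Matrix (Fin 4) (Fin 4) (w.1.adicCompletion L)) i j
  rw [coe_jLoc_apply, coe_klingenLevi]
  have hm := map_klingenLeviM_one (R := AdeleRing (𝓞 L) L) (R' := LocalRing L v) (conjAdele (Fp L) L (IsCMField.complexConj L)) (conjLocal L (IsCMField.complexConj L) v) (adeleToLocal L v)
    ((jAdelic L 2).symm y)
    ((jLoc L 2 v).symm (UnitaryGroup.evalPlace (Fp L) L (IsCMField.complexConj L) 2 ((StdForm.antidiagonal 2).over L) v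
      (UnitaryGroup.finPart (Fp L) L (IsCMField.complexConj L) 2 ((StdForm.antidiagonal 2).over L) y))) hy i j
  rw [← hm, adeleToLocal_apply]

/-! ## §3 The place component `Ψ_v` of a homomorphism of adelic unitary groups -/

/-- **`Ψ_v := (·)_v ∘ Ψ ∘ ι_v : U(J)(L⁺_v) →* U(J′)(L⁺_v)`** — the place-`v` component of a homomorphism `Ψ : U(J)(𝔸_{L⁺}) →* U(J′)(𝔸_{L⁺})` (★ `inclPlaceAdelic`,
★ `finPart`, ★ `evalPlace`).  For the F-files' transport `Ψ : U(J₄)(𝔸) ≃ₜ* H(𝔸)` and for ★ `K2LiuKlingenTermTwoTransport`'s `Ψ_S` this is conjugation by the SAME matrix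
read at `v` (`evalPlace_finPart_eq_psiLoc`). [cite: BorelJacquet1979, §4.1] [cite: PlatonovRapinchuk1994, §5.1] -/
def psiLoc {N N' : ℕ} {J : Matrix (Fin N) (Fin N) L} {J' : Matrix (Fin N') (Fin N') L}
    (Ψ : (adelicGroupData (Fp L) L (IsCMField.complexConj L) N J).Adelic →* (adelicGroupData (Fp L) L (IsCMField.complexConj L) N' J').Adelic)
    (v : HeightOneSpectrum (𝓞 (Fp L))) :
    UnitaryGroup.localPi L (IsCMField.complexConj L) N J v →* UnitaryGroup.localPi L (IsCMField.complexConj L) N' J' v :=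
  ((UnitaryGroup.evalPlace (Fp L) L (IsCMField.complexConj L) N' J' v).comp (UnitaryGroup.finPart (Fp L) L (IsCMField.complexConj L) N' J')).comp
    (Ψ.comp (UnitaryGroup.inclPlaceAdelic (Fp L) L (IsCMField.complexConj L) N J v))

/-- unfolding `psiLoc`. [cite: BorelJacquet1979, §4.1] -/
theorem psiLoc_apply {N N' : ℕ} {J : Matrix (Fin N) (Fin N) L} {J' : Matrix (Fin N') (Fin N') L}
    (Ψ : (adelicGroupData (Fp L) L (IsCMField.complexConj L) N J).Adelic →* (adelicGroupData (Fp L) L (IsCMField.complexConj L) N' J').Adelic)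
    (v : HeightOneSpectrum (𝓞 (Fp L))) (u : UnitaryGroup.localPi L (IsCMField.complexConj L) N J v) :
    psiLoc L Ψ v u = UnitaryGroup.evalPlace (Fp L) L (IsCMField.complexConj L) N' J' v
      (UnitaryGroup.finPart (Fp L) L (IsCMField.complexConj L) N' J' (Ψ (UnitaryGroup.inclPlaceAdelic (Fp L) L (IsCMField.complexConj L) N J v u))) := rfl

/-- the `w`-block of the `v`-component of `h ∈ U(J)(𝔸)` is the `w`-evaluation of the finite part of its adelic matrix (★ `coe_evalPlace_apply`, ★ `coe_finPart`).
[cite: BorelJacquet1979, §4.1] -/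
theorem evalPlace_finPart_eq_evalAt {N : ℕ} {J : Matrix (Fin N) (Fin N) L} (v : HeightOneSpectrum (𝓞 (Fp L)))
    (h : (adelicGroupData (Fp L) L (IsCMField.complexConj L) N J).Adelic) (w : UnitaryGroup.PlacesOver L v) :
    ((UnitaryGroup.evalPlace (Fp L) L (IsCMField.complexConj L) N J v (UnitaryGroup.finPart (Fp L) L (IsCMField.complexConj L) N J h) :
        UnitaryGroup.localPi L (IsCMField.complexConj L) N J v) : UnitaryGroup.LocalGLPi L N v) w =
      GLn.evalAt N L w.1 (GLn.sndHom N L h.1) := rfl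

/-- **`(Ψ g)_v = Ψ_v(g_v)`** whenever `Ψ` is conjugation by an adelic matrix `S_𝔸` (the F-files' pin `hΨ`; for ★ `adelicUnitaryGroupCongr L S _ _ hc` it is ★
`coe_adelicUnitaryGroupCongr`): both sides have `w`-block `(S_𝔸)_w · g_w · (S_𝔸)_w⁻¹` (★ `evalPlace_finPart_inclPlaceAdelic`: `(ι_v g_v)_v = g_v`).
[cite: BorelJacquet1979, §4.1] [cite: PlatonovRapinchuk1994, §5.1] -/
theorem evalPlace_finPart_eq_psiLoc {N : ℕ} {J J' : Matrix (Fin N) (Fin N) L}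
    (Ψ : (adelicGroupData (Fp L) L (IsCMField.complexConj L) N J).Adelic →* (adelicGroupData (Fp L) L (IsCMField.complexConj L) N J').Adelic)
    (SA : GL (Fin N) (AdeleRing (𝓞 L) L))
    (hΨ : ∀ g : (adelicGroupData (Fp L) L (IsCMField.complexConj L) N J).Adelic,
      (((Ψ g).1 : GL (Fin N) (AdeleRing (𝓞 L) L)) : Matrix (Fin N) (Fin N) (AdeleRing (𝓞 L) L)) =
        (SA : Matrix (Fin N) (Fin N) (AdeleRing (𝓞 L) L)) *
          ((adelicVal (Fp L) L (IsCMField.complexConj L) N J g : GL (Fin N) (AdeleRing (𝓞 L) L)) : Matrix (Fin N) (Fin N) (AdeleRing (𝓞 L) L)) *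
          ((SA⁻¹ : GL (Fin N) (AdeleRing (𝓞 L) L)) : Matrix (Fin N) (Fin N) (AdeleRing (𝓞 L) L)))
    (v : HeightOneSpectrum (𝓞 (Fp L))) (g : (adelicGroupData (Fp L) L (IsCMField.complexConj L) N J).Adelic) :
    UnitaryGroup.evalPlace (Fp L) L (IsCMField.complexConj L) N J' v (UnitaryGroup.finPart (Fp L) L (IsCMField.complexConj L) N J' (Ψ g)) =
      psiLoc L Ψ v (UnitaryGroup.evalPlace (Fp L) L (IsCMField.complexConj L) N J v (UnitaryGroup.finPart (Fp L) L (IsCMField.complexConj L) N J g)) := by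
  have hΨ' : ∀ g : (adelicGroupData (Fp L) L (IsCMField.complexConj L) N J).Adelic, ((Ψ g).1 : GL (Fin N) (AdeleRing (𝓞 L) L)) = SA * g.1 * SA⁻¹ := fun g =>
    Units.ext (by rw [hΨ g, Units.val_mul, Units.val_mul, adelicVal_apply])
  refine Subtype.ext (funext fun w => ?_)
  have h1 := evalPlace_finPart_eq_evalAt L v (UnitaryGroup.inclPlaceAdelic (Fp L) L (IsCMField.complexConj L) N J v
    (UnitaryGroup.evalPlace (Fp L) L (IsCMField.complexConj L) N J v (UnitaryGroup.finPart (Fp L) L (IsCMField.complexConj L) N J g))) w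
  rw [UnitaryGroup.evalPlace_finPart_inclPlaceAdelic] at h1
  have h2 := evalPlace_finPart_eq_evalAt L v g w
  rw [psiLoc_apply, evalPlace_finPart_eq_evalAt, evalPlace_finPart_eq_evalAt, hΨ', hΨ']
  simp only [map_mul, map_inv, ← h1, h2]

/-- **the place components of the term-2 argument**: for `Ψ` pinned by `hΨ`, `y ∈ Y`, `t ∈ 𝔸_L`, `g₂ ∈ U(J₂)(𝔸)`, `h ∈ U(J′)(𝔸)`,
`(Ψ(ξ) · Ψ(n_Q(y,0,t)) · (Ψ(m_Q(1, j₂⁻¹ g₂)) · h))_v = Ψ_v(ξ_v · n_{Q,v}(y_v, 0, t_v) · m_{Q,v}(1, (g₂)_v)) · h_v` — the integrand of ★ F8's inner section read at `v`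
(`evalPlace`, `finPart`, `Ψ_v` are homomorphisms; §2's three letter lemmas). This is the shape (F) binder `hF` of ★ FILE D once `f_s` is ★ #31s-factorizable.
[cite: BorelJacquet1979, §4.1] [cite: MoeglinWaldspurger1995, II.1.7] -/
theorem evalPlace_finPart_letters {J' : Matrix (Fin 4) (Fin 4) L}
    (Ψ : (adelicGroupData (Fp L) L (IsCMField.complexConj L) 4 ((StdForm.antidiagonal 4).over L)).Adelic →* (adelicGroupData (Fp L) L (IsCMField.complexConj L) 4 J').Adelic)
    (SA : GL (Fin 4) (AdeleRing (𝓞 L) L))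
    (hΨ : ∀ g : (adelicGroupData (Fp L) L (IsCMField.complexConj L) 4 ((StdForm.antidiagonal 4).over L)).Adelic,
      (((Ψ g).1 : GL (Fin 4) (AdeleRing (𝓞 L) L)) : Matrix (Fin 4) (Fin 4) (AdeleRing (𝓞 L) L)) =
        (SA : Matrix (Fin 4) (Fin 4) (AdeleRing (𝓞 L) L)) *
          ((adelicVal (Fp L) L (IsCMField.complexConj L) 4 ((StdForm.antidiagonal 4).over L) g : GL (Fin 4) (AdeleRing (𝓞 L) L)) :
            Matrix (Fin 4) (Fin 4) (AdeleRing (𝓞 L) L)) *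
          ((SA⁻¹ : GL (Fin 4) (AdeleRing (𝓞 L) L)) : Matrix (Fin 4) (Fin 4) (AdeleRing (𝓞 L) L)))
    (v : HeightOneSpectrum (𝓞 (Fp L))) (y : AdeleRing (𝓞 L) L) (hy : conjAdele (Fp L) L (IsCMField.complexConj L) y = -y) (t : AdeleRing (𝓞 L) L)
    (g₂ : (quasiSplit (Fp L) L (IsCMField.complexConj L) 2).Adelic) (h : (adelicGroupData (Fp L) L (IsCMField.complexConj L) 4 J').Adelic) :
    UnitaryGroup.evalPlace (Fp L) L (IsCMField.complexConj L) 4 J' v (UnitaryGroup.finPart (Fp L) L (IsCMField.complexConj L) 4 J'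
        (Ψ (jAdelic L 4 (weylXi (AdeleRing (𝓞 L) L) (conjAdele (Fp L) L (IsCMField.complexConj L)))) *
          Ψ (jAdelic L 4 (nKlingen (AdeleRing (𝓞 L) L) (conjAdele (Fp L) L (IsCMField.complexConj L)) (conjAdele_conjAdele' L) y hy 0 t)) *
          (Ψ (jAdelic L 4 (klingenLevi (AdeleRing (𝓞 L) L) (conjAdele (Fp L) L (IsCMField.complexConj L)) (conjAdele_conjAdele' L) 1 ((jAdelic L 2).symm g₂))) * h))) =
      psiLoc L Ψ v (weylXiLoc L v * nKlingenLoc L v (adeleToLocal L v y) ((mem_skewLoc_iff L v _).1 (adeleToLocal_mem_skewLoc L v hy)) (adeleToLocal L v 0) (adeleToLocal L v t) *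
          klingenLeviLoc L v 1 (UnitaryGroup.evalPlace (Fp L) L (IsCMField.complexConj L) 2 ((StdForm.antidiagonal 2).over L) v
            (UnitaryGroup.finPart (Fp L) L (IsCMField.complexConj L) 2 ((StdForm.antidiagonal 2).over L) g₂))) *
        UnitaryGroup.evalPlace (Fp L) L (IsCMField.complexConj L) 4 J' v (UnitaryGroup.finPart (Fp L) L (IsCMField.complexConj L) 4 J' h) := by
  simp only [map_mul, evalPlace_finPart_eq_psiLoc L Ψ SA hΨ, evalPlace_finPart_weylXi, evalPlace_finPart_nKlingen, evalPlace_finPart_klingenLevi_one, mul_assoc]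

/-! ## §4 The local inner functional `J_v` of the Klingen fibre -/

section InnerLoc

open MeasureTheory

/-- **`J_v` — THE LOCAL INNER FUNCTIONAL OF THE KLINGEN FIBRE AT `v`**: for local measures `ν_Y` on `Y_v` and `ν_T` on `L_v`, a local transport
`Ψ_v : U(J₄)(L⁺_v) →* U(J′)(L⁺_v)` (intended: `psiLoc Ψ v`), a local section `f_v : U(J′)(L⁺_v) → ℂ` (intended: ★ `LambdaLoc … v χ s` off `T′`), `x_v ∈ U(J′)(L⁺_v)`
(intended: `h_v`) and `y_v ∈ U(J₂)(L⁺_v)`:  `J_v(y_v) := ∫_{Y_v × L_v} f_v(Ψ_v(ξ_v · n_{Q,v}(q.1, 0, q.2) · m_{Q,v}(1, y_v)) · x_v) d(ν_Y ⊗ ν_T)(q)` — the place-`v` factor of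
★ F8's inner section `F′_h` (FILE D's `φ_v`; FILE C: its Borel law at `s − ½` and right-`K`-invariance ⇒ `J_v = J_v(1) · Λ^{line}_{s−½,v} ∘ Ψ_{S,v}`).
Junk: Bochner `0` off integrability. [cite: MoeglinWaldspurger1995, II.1.7] [cite: Tan1999, §2] [cite: BorelJacquet1979, §4.1] -/
def innerSectionLoc (v : HeightOneSpectrum (𝓞 (Fp L))) [MeasurableSpace ↥(skewLoc L v)] [MeasurableSpace (LocalRing L v)]
    (νY : Measure ↥(skewLoc L v)) (νT : Measure (LocalRing L v)) {N' : ℕ} {J' : Matrix (Fin N') (Fin N') L}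
    (Ψv : UnitaryGroup.localPi L (IsCMField.complexConj L) 4 ((StdForm.antidiagonal 4).over L) v →* UnitaryGroup.localPi L (IsCMField.complexConj L) N' J' v)
    (fv : UnitaryGroup.localPi L (IsCMField.complexConj L) N' J' v → ℂ) (xv : UnitaryGroup.localPi L (IsCMField.complexConj L) N' J' v)
    (yv : UnitaryGroup.localPi L (IsCMField.complexConj L) 2 ((StdForm.antidiagonal 2).over L) v) : ℂ :=
  ∫ q : ↥(skewLoc L v) × LocalRing L v, fv (Ψv (weylXiLoc L v * nKlingenLoc L v (q.1 : LocalRing L v) q.1.2 0 q.2 * klingenLeviLoc L v 1 yv) * xv) ∂(νY.prod νT)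

/-- unfolding `innerSectionLoc`. [cite: MoeglinWaldspurger1995, II.1.7] -/
theorem innerSectionLoc_def (v : HeightOneSpectrum (𝓞 (Fp L))) [MeasurableSpace ↥(skewLoc L v)] [MeasurableSpace (LocalRing L v)]
    (νY : Measure ↥(skewLoc L v)) (νT : Measure (LocalRing L v)) {N' : ℕ} {J' : Matrix (Fin N') (Fin N') L}
    (Ψv : UnitaryGroup.localPi L (IsCMField.complexConj L) 4 ((StdForm.antidiagonal 4).over L) v →* UnitaryGroup.localPi L (IsCMField.complexConj L) N' J' v)
    (fv : UnitaryGroup.localPi L (IsCMField.complexConj L) N' J' v → ℂ) (xv : UnitaryGroup.localPi L (IsCMField.complexConj L) N' J' v)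
    (yv : UnitaryGroup.localPi L (IsCMField.complexConj L) 2 ((StdForm.antidiagonal 2).over L) v) :
    innerSectionLoc L v νY νT Ψv fv xv yv =
      ∫ q : ↥(skewLoc L v) × LocalRing L v, fv (Ψv (weylXiLoc L v * nKlingenLoc L v (q.1 : LocalRing L v) q.1.2 0 q.2 * klingenLeviLoc L v 1 yv) * xv) ∂(νY.prod νT) := rfl

/-- **`J_v` does not see right translations of `x_v` under which `f_v` is invariant** (e.g. `x_v ↦ x_v k`, `k ∈ K_{H,v}`, for the spherical ★ `LambdaLoc`: ★ `lambdaLoc_mul_localInt`):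
if `f_v(g k) = f_v(g)` for all `g` then `J_v[x_v k] = J_v[x_v]`. [cite: BorelJacquet1979, §4.1] -/
theorem innerSectionLoc_mul_right (v : HeightOneSpectrum (𝓞 (Fp L))) [MeasurableSpace ↥(skewLoc L v)] [MeasurableSpace (LocalRing L v)]
    (νY : Measure ↥(skewLoc L v)) (νT : Measure (LocalRing L v)) {N' : ℕ} {J' : Matrix (Fin N') (Fin N') L}
    (Ψv : UnitaryGroup.localPi L (IsCMField.complexConj L) 4 ((StdForm.antidiagonal 4).over L) v →* UnitaryGroup.localPi L (IsCMField.complexConj L) N' J' v)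
    (fv : UnitaryGroup.localPi L (IsCMField.complexConj L) N' J' v → ℂ) (xv k : UnitaryGroup.localPi L (IsCMField.complexConj L) N' J' v)
    (hk : ∀ g, fv (g * k) = fv g) (yv : UnitaryGroup.localPi L (IsCMField.complexConj L) 2 ((StdForm.antidiagonal 2).over L) v) :
    innerSectionLoc L v νY νT Ψv fv (xv * k) yv = innerSectionLoc L v νY νT Ψv fv xv yv := by
  simp only [innerSectionLoc, ← mul_assoc _ xv k, hk]

end InnerLoc

end Summit.HodgeConjecture.HodgeConjecture.Cruxes.HLiu418.K2LiuKlingenInnerSectionLocalDefs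

end
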